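import Mathlib
import Summits.Ventures.PercRepro2.KPrimeCycle
import Summits.Ventures.PercRepro2.CycleNecklace

/-!
# `(K′)` on every necklace (blind cell PercRepro2, mine-c g41; `conjectures/MINE-C.md` §50)

For a necklace (`IsNecklace`, `CycleNecklaceConn.lean`: `C₅` with each arc replaced by a mark-free
two-terminal block) the mark connectivities are those of `C₅` under the block pattern
(`conn_marks_iff_nk`), whose law is the product law of the block weights `nkProb`
(`prob_nkOpen_preimage`); so the lemma of record `(K′)` transports to `C₅`
(`KPrimeCycle.kprimeHolds_transport'`), where it holds at every placement for every weight vector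
(`KPrimeCycle.kprime_cycle5_all`).  **`kprime_necklace`**: `(K′)` for every admissible weight vector
and every placement of the five labels `a₁, a₂, b, v, y` on the five marks of a necklace.
-/

namespace Summit.Ventures.PercRepro2

namespace KPrimeCycle

open Cycle

section Necklace

variable {V : Type*} {E : Type*} [Fintype E] [DecidableEq E] [DecidableEq V]
variable {ends : E → Sym2 V} {q : Fin 5 → V} {blk : E → Fin 5} {Vj : Fin 5 → Set V}
variable {R : Type*} [Field R] [LinearOrder R] [IsStrictOrderedRing R]

/-- **`(K′)` on every necklace** for every admissible weight vector and every placement of the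
five labels on the five marks: the mark connectivities are those of `C₅` under the block pattern
(`conn_marks_iff_nk`), whose law is the product law of the block weights (`prob_nkOpen_preimage`),
so `(K′)` transports to `C₅` (`kprimeHolds_transport'`), where it holds at every placement
(`kprime_cycle5_all`). -/
theorem kprime_necklace (hN : IsNecklace ends q blk Vj) (p : E → R) (hp : IsProbVec p)
    (k₁ k₂ kb kv ky : Fin 5) (h12 : k₁ ≠ k₂) (h1b : k₁ ≠ kb) (h1v : k₁ ≠ kv) (h1y : k₁ ≠ ky)
    (h2b : k₂ ≠ kb) (h2v : k₂ ≠ kv) (h2y : k₂ ≠ ky) (hbv : kb ≠ kv) (hby : kb ≠ ky)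
    (hvy : kv ≠ ky) : KPrime.KPrimeHolds ends (q k₁) (q k₂) (q kb) (q kv) (q ky) p := by
  rw [(kprimeHolds_transport' (fun A => (prob_nkOpen_preimage p A).symm)
    (fun ω x z => (conn_marks_iff_nk hN ω x z).symm) k₁ k₂ kb kv ky).symm]
  exact kprime_cycle5_all (nkProb ends q blk p) (isProbVec_nkProb hp) k₁ k₂ kb kv ky
    h12 h1b h1v h1y h2b h2v h2y hbv hby hvy

end Necklace

end KPrimeCycle

end Summit.Ventures.PercRepro2
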